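import Summits.ResolutionOfSingularities.ResolutionOfSingularities.Theorems.PurelyInseparableDim4SwapTransportWindowWeightsSigma
import Summits.ResolutionOfSingularities.ResolutionOfSingularities.Theorems.PurelyInseparableDim4TschirnhausChain
import Summits.ResolutionOfSingularities.ResolutionOfSingularities.Theorems.PurelyInseparableDim4ResConeTwoSlotEntryFrameSigma
import HarnessLib
import HarnessLib.Audit.Tags

/-!
# Purely inseparable four-folds — σ FRAMED PLAY EXTRACTION, every prime, every σ = (n, n) + w (w ≥ 1, w ≠ n): the real σ-tail, read in
# ONE transported polynomial frame, is a two-slot play with constant weights, order, isolation and `e_G = 3` carried, and PURE at every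
# straight time (cell `res-dim4-pi`, K2(p) lane, B-LF (iii-b) K24a-PRIME-σ, transport layer, FILE T2′ — discharges the σ-assembly δ2's
# `hstep`/`ho`/`he3`/`hiso` binders, res-dim4-p-7 g6)

[OURS · counted 0 · cell `res-dim4-pi` · K2(p) lane (holder res-dim4-p-12 g5, rulings g5-17/18: transport layer = res-dim4-typ-1 g5; the
ENGINE is res-dim4-p-11 g3's E1/E2 `FrameChange.step_cleanTsch` / `FrameChange.exists_reframed_chain`, the rank transport is res-dim4-p-1 g6's
`FrameChange.finrank_resVertex_tschState_any` — all CITED BY NAME, not restated).]  Nothing here proves K2(p) for any `p`, any TAIL(p, d, 3),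
`NoIsolatedTrap p p` or resolution of singularities in dimension ≥ 4 / characteristic `p` — NOT proved.  AI kernel work, weaker than expert
review.  A re-framing statement about OUR frame's hypothetical `Step0 p` chains; kills nothing by itself.

SETTING (class (i) of the seat's map, bus 2026-08-29 12:42Z/12:54Z).  Letters `x, y` (slots, weight `n ≥ 1`), `v` (passive, weight `w ≥ 1`,
`w ≠ n`), `z` (the free form carrier of the T-normal form `ResCone.powerCone_freeCarrier_representation`: never charted, never boundary).
INPUT: a witnessed `Step0 p` chain `(c, j, β)` whose charts avoid `z`, clean at `c 0`, with σ-weights at every time (for SOME three letters),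
order `p + n` (`n + w + d = p`), `x^r ∣ F₀`, `e_G = 3` and isolation at every time, and ANY admissible frame datum `φ₀` (`z ∉ vars`, `φ₀(0) = 0`
— e.g. res-dim4-p-1's entry frame `FrameChange.twoSlot_entry_frame_sigma`, straightening + Tschirnhaus).
OUTPUT **`framed_play_sigma`** (and its SLOT EDITION `framed_play_slot_sigma`, where the charts are GIVEN to be slots and `w = n` is allowed —
the two-letter tails of the diagonal σ, res-dim4-p-1 g6's (i-diag-2), bus 13:13Z): the E2-re-framed chain `s k = T_{φ k} (c k)` (`φ 0 = φ₀`, `φ (k+1) = (φ k)⁺`) is a witnessed two-slot play with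
(a) CONSTANT weights `n·x + n·y + w·v` and slot charts `j k ∈ {x, y}` (T1 `step_cases_of_weights_sigma` on the real chain, by induction),
(b) order `p + n`, isolation, `x^r ∣ F` carried (E2), (c) `e_G = 3` carried at EVERY time (E1 `resVertex_cleanTschState_eq` in the band
`p ∤ p + n`, then `finrank_resVertex_tschState_any` — valid for every admissible `φ k`, so the growing higher-order part of the transported
frame is harmless), (d) PURE AT EVERY STRAIGHT TIME: whenever `resForm (s k) = a·x_z^d`, `a ≠ 0`, then `s (k+1) = step p univ (j k) 0 (s k)`
(T1 `pure_step_of_straight_sigma`: the re-framed translations vanish at the chart (witnessed), off `z` (they agree with `β k`, which T1 pins)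
and at `z` (σ-(VT-f))), (e) the entry's readings of `tsch z φ₀ F₀` ARE the readings of `s 0` off the `p`-th-power lattice (cleaning deletes
`p`-th powers only; `r + m` has `x`-entry `n + m_x ∈ [1, p − 1]` for `|m| ≤ d`).  With the entry's `ha0`/`hstraight0`/`htsch0` at a letter-change time and the slot ledger there, res-dim4-p-7's δ2
`ResCone.no_twoSlot_pureCorner_play_sigma` (guarded form) closes class (i).
[cite: CossartJannsenSaito2020, Thm. 3.14] [cite: Hauser2010, §§F–G, I] [cite: HauserPerlega2019PRIMS, §2 (transform D′ of D)]
bears_on: LADDER-RESOLUTION:D157-DOOR2 (res-dim4-pi · K2(p) B-LF (iii-b) K24a-PRIME-σ transport layer T2′).  Supports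
stmt-ResolutionOfSingularities-16155 (helper).
-/

set_option linter.dupNamespace false -- mandated namespace of this single-conjunct summit

noncomputable section

namespace Summit.ResolutionOfSingularities.ResolutionOfSingularities.Theorems.PIDim4

namespace SwapTransport

open MvPolynomial Finset
open Literature.AlgebraicGeometry.Resolution
open Literature.AlgebraicGeometry.Resolution.CentreBlowup
open Literature.AlgebraicGeometry.Resolution.Hauser2010
open Literature.AlgebraicGeometry.Resolution.HauserPerlega2019

variable {K : Type} [Field K] [DecidableEq K]

/-! ## §0 Slot editions of T1 §1/§4 (the chart is GIVEN to be a slot; any `w ≥ 1`, also the diagonal `w = n`) -/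

/-- **A σ-KEEPING SLOT STEP TRANSLATES NOTHING BUT THE CARRIER** (σ = (n, n) + w, `0 < n`, `0 < w`, any `w`): if the chart `jr` is a slot
and the child is again a σ-state for some three letters, then `b` vanishes off `z` and the weights are unchanged letter for letter (the
child has three positive weights and weight `0` at `z`, so they sit on `x, y, v`). [OURS] [cite: HauserPerlega2019PRIMS, §2 (transform D′ of D)] -/
theorem step_cases_of_slot_sigma (p : ℕ) {n w : ℕ} (hn : 0 < n) (hw : 0 < w) {x y v z : Fin 4} (hxy : x ≠ y) (hxv : x ≠ v)
    (hxz : x ≠ z) (hyv : y ≠ v) (hyz : y ≠ z) (hvz : v ≠ z) {A : State K}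
    (hrA : A.r = Finsupp.single x n + Finsupp.single y n + Finsupp.single v w) (ho : ordZero A.F = ((p + n : ℕ) : ℕ∞))
    {jr : Fin 4} (hslot : jr = x ∨ jr = y) {b : Fin 4 → K} (hbj : b jr = 0)
    (hrA' : ∃ x' y' v' : Fin 4, x' ≠ y' ∧ x' ≠ v' ∧ y' ≠ v' ∧
      (CentreBlowup.step p Finset.univ jr b A).r = Finsupp.single x' n + Finsupp.single y' n + Finsupp.single v' w) :
    (∀ ℓ, ℓ ≠ z → b ℓ = 0) ∧ (CentreBlowup.step p Finset.univ jr b A).r = A.r := by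
  obtain ⟨x', y', v', hx'y', hx'v', hy'v', hr'⟩ := hrA'
  obtain ⟨hAx, hAy, -, hAz⟩ : A.r x = n ∧ A.r y = n ∧ A.r v = w ∧ A.r z = 0 := by
    rw [hrA]; exact sigma_weights_values hxy hxv hxz hyv hyz hvz n w
  have hval : ∀ ℓ, (CentreBlowup.step p Finset.univ jr b A).r ℓ = if ℓ = jr then n else if b ℓ = 0 then A.r ℓ else 0 := by
    intro ℓ; rw [step_r_apply_gen p ho jr b ℓ, Nat.add_sub_cancel_left]
  have hjz : jr ≠ z := by
    rcases hslot with h | h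
    · rw [h]; exact hxz
    · rw [h]; exact hyz
  have hAjr : A.r jr = n := by
    rcases hslot with h | h
    · rw [h, hAx]
    · rw [h, hAy]
  have h1 : (CentreBlowup.step p Finset.univ jr b A).r x' = n := by
    rw [hr', Finsupp.add_apply, Finsupp.add_apply, Finsupp.single_eq_same, Finsupp.single_eq_of_ne hx'y',
      Finsupp.single_eq_of_ne hx'v']; omega
  have h2 : (CentreBlowup.step p Finset.univ jr b A).r y' = n := by
    rw [hr', Finsupp.add_apply, Finsupp.add_apply, Finsupp.single_eq_of_ne hx'y'.symm, Finsupp.single_eq_same,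
      Finsupp.single_eq_of_ne hy'v']; omega
  have h3 : (CentreBlowup.step p Finset.univ jr b A).r v' = w := by
    rw [hr', Finsupp.add_apply, Finsupp.add_apply, Finsupp.single_eq_of_ne hx'v'.symm, Finsupp.single_eq_of_ne hy'v'.symm,
      Finsupp.single_eq_same]; omega
  have hz : (CentreBlowup.step p Finset.univ jr b A).r z = 0 := by
    rw [hval, if_neg (fun h => hjz h.symm)]
    split_ifs
    · exact hAz
    · rfl
  have hx'z : x' ≠ z := fun h => by rw [h, hz] at h1; omega
  have hy'z : y' ≠ z := fun h => by rw [h, hz] at h2; omega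
  have hv'z : v' ≠ z := fun h => by rw [h, hz] at h3; omega
  -- every letter but `z` has a positive child weight, hence is untranslated
  have hpos : ∀ ℓ, ℓ ≠ z → (CentreBlowup.step p Finset.univ jr b A).r ℓ ≠ 0 := by
    intro ℓ hℓz
    rcases ResCone.letters_exhaust hx'y' hx'v' hx'z hy'v' hy'z hv'z ℓ with h | h | h | h
    · rw [h, h1]; omega
    · rw [h, h2]; omega
    · rw [h, h3]; omega
    · exact absurd h hℓz
  have hb : ∀ ℓ, ℓ ≠ z → b ℓ = 0 := by
    intro ℓ hℓz
    by_cases hℓj : ℓ = jr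
    · rw [hℓj]; exact hbj
    have h := hpos ℓ hℓz
    rw [hval, if_neg hℓj] at h
    by_contra hbℓ
    rw [if_neg hbℓ] at h
    exact h rfl
  refine ⟨hb, ?_⟩
  ext ℓ
  rw [hval]
  by_cases hℓj : ℓ = jr
  · rw [if_pos hℓj, hℓj, hAjr]
  · rw [if_neg hℓj]
    by_cases hℓz : ℓ = z
    · rw [hℓz, hAz]; split_ifs <;> rfl
    · rw [if_pos (hb ℓ hℓz)]

/-- **PURE STEP EXTRACTION, slot edition** (σ = (n, n) + w, any `w ≥ 1`): an honest step from a STRAIGHT σ-state in a SLOT chart, whose child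
is again a σ-state of order `p + n`, has translation `b = 0` and keeps the weights. [OURS] [cite: CossartJannsenSaito2020, Thm. 3.14] -/
theorem pure_step_of_straight_slot_sigma (p : ℕ) {n w d : ℕ} (hσ : n + w + d = p) (hn : 0 < n) (hw : 0 < w) (hd1 : 1 ≤ d)
    {x y v z : Fin 4} (hxy : x ≠ y) (hxv : x ≠ v) (hxz : x ≠ z) (hyv : y ≠ v) (hyz : y ≠ z) (hvz : v ≠ z) {A : State K}
    (hrA : A.r = Finsupp.single x n + Finsupp.single y n + Finsupp.single v w) (hdivA : ∀ e ∈ A.F.support, A.r ≤ e)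
    (ho : ordZero A.F = ((p + n : ℕ) : ℕ∞)) {a : K} (ha : a ≠ 0) (hformA : ResCone.resForm A = C a * X z ^ d) {jr : Fin 4}
    (hslot : jr = x ∨ jr = y) {b : Fin 4 → K} (hbj : b jr = 0)
    (hrA' : ∃ x' y' v' : Fin 4, x' ≠ y' ∧ x' ≠ v' ∧ y' ≠ v' ∧
      (CentreBlowup.step p Finset.univ jr b A).r = Finsupp.single x' n + Finsupp.single y' n + Finsupp.single v' w)
    (ho' : ordZero (CentreBlowup.step p Finset.univ jr b A).F = ((p + n : ℕ) : ℕ∞)) :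
    b = 0 ∧ (CentreBlowup.step p Finset.univ jr b A).r = A.r := by
  obtain ⟨hbz, hr'⟩ := step_cases_of_slot_sigma p hn hw hxy hxv hxz hyv hyz hvz hrA ho hslot hbj hrA'
  obtain ⟨hAx, hAy, -, hAz⟩ : A.r x = n ∧ A.r y = n ∧ A.r v = w ∧ A.r z = 0 := by
    rw [hrA]; exact sigma_weights_values hxy hxv hxz hyv hyz hvz n w
  have hrdeg : A.r.degree + d = p + n := by
    rw [hrA, map_add, map_add, Finsupp.degree_single, Finsupp.degree_single, Finsupp.degree_single]; omega
  have hjz : jr ≠ z := by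
    rcases hslot with h | h
    · rw [h]; exact hxz
    · rw [h]; exact hyz
  have hrjr : A.r jr = n := by
    rcases hslot with h | h
    · rw [h, hAx]
    · rw [h, hAy]
  have hin : initialForm A.F = monomial (A.r + Finsupp.single z d) a := initialForm_eq_of_resForm_sigma hdivA hformA
  have hbzero : b z = 0 :=
    ResCone.translation_contact_eq_zero_sigma_of_eq p hd1 hn (by omega) hjz hAz hrjr hrdeg ho ha hin hbz ho'
  refine ⟨funext fun ℓ => ?_, hr'⟩
  show b ℓ = 0
  by_cases h : ℓ = z
  · rw [h, hbzero]
  · exact hbz ℓ h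

/-- `p ∤ p + n` for `0 < n < p`. [folklore] -/
theorem not_dvd_add_of_pos_of_lt {p n : ℕ} (hn : 0 < n) (hnp : n < p) : ¬ p ∣ p + n := by
  intro h
  have h' : p ∣ n := by simpa using (Nat.dvd_add_right (dvd_refl p)).mp h
  exact absurd (Nat.le_of_dvd hn h') (by omega)

/-! ## §1 The framed play, slot edition (charts GIVEN to be slots: any `w ≥ 1`, also the diagonal `w = n`) -/

/-- **σ FRAMED PLAY EXTRACTION, slot edition.**  As `framed_play_sigma`, but the charts of the real tail are GIVEN to be the slots `x, y`
(no `w ≠ n`): the diagonal σ's two-letter tails are served too (res-dim4-p-1 g6's (i-diag-2)). [OURS]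
[cite: CossartJannsenSaito2020, Thm. 3.14] [cite: Hauser2010, §§F–G, I] -/
theorem framed_play_slot_sigma (p : ℕ) [Fact p.Prime] [CharP K p] {n w d : ℕ} (hσ : n + w + d = p) (hn : 0 < n) (hw : 0 < w)
    (hd1 : 1 ≤ d) {x y v z : Fin 4} (hxy : x ≠ y) (hxv : x ≠ v) (hxz : x ≠ z) (hyv : y ≠ v) (hyz : y ≠ z) (hvz : v ≠ z)
    {c : ℕ → State K} {j : ℕ → Fin 4} {β : ℕ → Fin 4 → K} (hwit : FreeTail.IsWitnessedChain p c j β)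
    (hclean : deletePthPowers p (c 0).F = (c 0).F) (hslotR : ∀ k, j k = x ∨ j k = y) (hez : z ∉ (c 0).exc)
    (hr0 : (c 0).r = Finsupp.single x n + Finsupp.single y n + Finsupp.single v w)
    (hσtail : ∀ k, ∃ x' y' v' : Fin 4, x' ≠ y' ∧ x' ≠ v' ∧ y' ≠ v' ∧
      (c k).r = Finsupp.single x' n + Finsupp.single y' n + Finsupp.single v' w)
    (ho : ∀ k, ordZero (c k).F = ((p + n : ℕ) : ℕ∞)) (hdiv0 : ∀ e ∈ (c 0).F.support, (c 0).r ≤ e)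
    (he3 : ∀ k, Module.finrank K (ResCone.resVertex (c k)) = 3) (hiso : ∀ k, IsIsolated p (c k).F)
    {φ₀ : MvPolynomial (Fin 4) K} (hφ : z ∉ φ₀.vars) (h0 : constantCoeff φ₀ = 0) :
    ∃ (φ : ℕ → MvPolynomial (Fin 4) K) (b : ℕ → Fin 4 → K) (s : ℕ → State K),
      φ 0 = φ₀ ∧ (∀ k, z ∉ (φ k).vars ∧ constantCoeff (φ k) = 0) ∧
      (∀ k, s k = ⟨deletePthPowers p (FrameChange.tsch z (φ k) (c k).F), (c k).r, (c k).exc⟩) ∧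
      FreeTail.IsWitnessedChain p s j b ∧
      (∀ k, (s k).r = Finsupp.single x n + Finsupp.single y n + Finsupp.single v w) ∧
      (∀ k, ordZero (s k).F = ((p + n : ℕ) : ℕ∞)) ∧ (∀ k, IsIsolated p (s k).F) ∧
      (∀ k, Module.finrank K (ResCone.resVertex (s k)) = 3) ∧
      (∀ k, ∀ e ∈ (s k).F.support, (s k).r ≤ e) ∧
      (∀ k, (∃ a : K, a ≠ 0 ∧ ResCone.resForm (s k) = C a * X z ^ d) →
        s (k + 1) = CentreBlowup.step p Finset.univ (j k) 0 (s k)) ∧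
      (∀ e : Fin 4 →₀ ℕ, ¬ IsPthPowerExponent p e → coeff e (s 0).F = coeff e (FrameChange.tsch z φ₀ (c 0).F)) := by
  classical
  have hσv := sigma_weights_values hxy hxv hxz hyv hyz hvz n w
  have hjz : ∀ k, j k ≠ z := fun k => by
    rcases hslotR k with h | h
    · rw [h]; exact hxz
    · rw [h]; exact hyz
  -- (0) along the REAL chain: weights constant, translations off `z` vanish, `x^r ∣ F`
  have hstepR : ∀ k, c (k + 1) = CentreBlowup.step p Finset.univ (j k) (β k) (c k) := fun k => (hwit k).2.2.2.2
  have hβj : ∀ k, β k (j k) = 0 := fun k => (hwit k).2.1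
  have hrR : ∀ k, (c k).r = Finsupp.single x n + Finsupp.single y n + Finsupp.single v w := by
    intro k
    induction k with
    | zero => exact hr0
    | succ k ih =>
      obtain ⟨x', y', v', h1, h2, h3, hr'⟩ := hσtail (k + 1)
      rw [hstepR k] at hr' ⊢
      exact (step_cases_of_slot_sigma p hn hw hxy hxv hxz hyv hyz hvz ih (ho k) (hslotR k) (hβj k)
        ⟨x', y', v', h1, h2, h3, hr'⟩).2.trans ih
  have hdivR : ∀ k, ∀ e ∈ (c k).F.support, (c k).r ≤ e := by
    intro k
    induction k with
    | zero => exact hdiv0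
    | succ k ih => rw [hstepR k]; exact forall_le_step_gen (q := p) (c k) ih (j k) (hβj k)
  have hzR : ∀ k, (c k).r z = 0 := fun k => by rw [hrR k]; exact hσv.2.2.2
  -- (1) E2: the re-framed chain
  obtain ⟨φ, b, s, hφ0, hφk, hsk, hwit', -, -, hcarry⟩ :=
    FrameChange.exists_reframed_chain p hwit hclean hjz (hzR 0) hez hφ h0
  -- (2) carried facts
  have hrs : ∀ k, (s k).r = Finsupp.single x n + Finsupp.single y n + Finsupp.single v w :=
    fun k => (hcarry k).1.trans (hrR k)
  have hos : ∀ k, ordZero (s k).F = ((p + n : ℕ) : ℕ∞) := fun k => (hcarry k).2.2.1.trans (ho k)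
  have hisos : ∀ k, IsIsolated p (s k).F := fun k => (hcarry k).2.2.2.2.2.1.mpr (hiso k)
  have hdivs : ∀ k, ∀ e ∈ (s k).F.support, (s k).r ≤ e := fun k => (hcarry k).2.2.2.2.2.2 (hdivR k)
  have hpo : ¬ p ∣ p + n := not_dvd_add_of_pos_of_lt hn (by omega)
  have he3s : ∀ k, Module.finrank K (ResCone.resVertex (s k)) = 3 := by
    intro k
    rw [hsk k, FrameChange.resVertex_cleanTschState_eq p (hφk k).1 (hφk k).2 (ho k) hpo,
      FrameChange.finrank_resVertex_tschState_any (hφk k).2 (hφk k).1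
        (c := fun i => if i = z then 0 else coeff (Finsupp.single i 1) (φ k)) (if_pos rfl)
        (fun i hi => by rw [if_neg hi]) (hzR k) (hdivR k)]
    exact he3 k
  -- (3) purity at every straight time
  have hpure : ∀ k, (∃ a : K, a ≠ 0 ∧ ResCone.resForm (s k) = C a * X z ^ d) →
      s (k + 1) = CentreBlowup.step p Finset.univ (j k) 0 (s k) := by
    rintro k ⟨a, ha, hform⟩
    have hst : s (k + 1) = CentreBlowup.step p Finset.univ (j k) (b k) (s k) := (hwit' k).2.2.2.2
    have hbj : b k (j k) = 0 := (hwit' k).2.1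
    have hb0 : b k = 0 := by
      refine (pure_step_of_straight_slot_sigma p hσ hn hw hd1 hxy hxv hxz hyv hyz hvz (hrs k) (hdivs k) (hos k) ha hform
        (hslotR k) hbj ⟨x, y, v, hxy, hxv, hyv, ?_⟩ ?_).1
      · rw [← hst]; exact hrs (k + 1)
      · rw [← hst]; exact hos (k + 1)
    rw [hst, hb0]
  -- (4) the entry readings survive the cleaning off the `p`-th-power lattice
  have hread0 : ∀ e : Fin 4 →₀ ℕ, ¬ IsPthPowerExponent p e → coeff e (s 0).F = coeff e (FrameChange.tsch z φ₀ (c 0).F) := by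
    intro e he
    rw [hsk 0, hφ0, coeff_deletePthPowers, if_neg he]
  exact ⟨φ, b, s, hφ0, hφk, hsk, hwit', hrs, hos, hisos, he3s, hdivs, hpure, hread0⟩

/-! ## §2 The framed play, class (i): `w ≠ n`, charts only known to avoid the carrier -/

/-- **σ FRAMED PLAY EXTRACTION, every prime, every σ = (n, n) + w (w ≥ 1, w ≠ n).**  See the module docstring: the real σ-tail in
T-normal form (charts avoid the carrier `z`), re-framed by E2 from any admissible frame datum `φ₀`, is a witnessed two-slot play with constant
weights and SLOT charts (T1 §1: with `w ≠ n` the weights force the chart into a slot), order `p + n`, isolation, `x^r ∣ F` and `e_G = 3`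
at every time, and PURE at every straight time. [OURS] [cite: CossartJannsenSaito2020, Thm. 3.14] [cite: Hauser2010, §§F–G, I] -/
theorem framed_play_sigma (p : ℕ) [Fact p.Prime] [CharP K p] {n w d : ℕ} (hσ : n + w + d = p) (hn : 0 < n) (hw : 0 < w)
    (hwn : w ≠ n) (hd1 : 1 ≤ d) {x y v z : Fin 4} (hxy : x ≠ y) (hxv : x ≠ v) (hxz : x ≠ z) (hyv : y ≠ v) (hyz : y ≠ z)
    (hvz : v ≠ z) {c : ℕ → State K} {j : ℕ → Fin 4} {β : ℕ → Fin 4 → K} (hwit : FreeTail.IsWitnessedChain p c j β)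
    (hclean : deletePthPowers p (c 0).F = (c 0).F) (hjz : ∀ k, j k ≠ z) (hez : z ∉ (c 0).exc)
    (hr0 : (c 0).r = Finsupp.single x n + Finsupp.single y n + Finsupp.single v w)
    (hσtail : ∀ k, ∃ x' y' v' : Fin 4, x' ≠ y' ∧ x' ≠ v' ∧ y' ≠ v' ∧
      (c k).r = Finsupp.single x' n + Finsupp.single y' n + Finsupp.single v' w)
    (ho : ∀ k, ordZero (c k).F = ((p + n : ℕ) : ℕ∞)) (hdiv0 : ∀ e ∈ (c 0).F.support, (c 0).r ≤ e)
    (he3 : ∀ k, Module.finrank K (ResCone.resVertex (c k)) = 3) (hiso : ∀ k, IsIsolated p (c k).F)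
    {φ₀ : MvPolynomial (Fin 4) K} (hφ : z ∉ φ₀.vars) (h0 : constantCoeff φ₀ = 0) :
    ∃ (φ : ℕ → MvPolynomial (Fin 4) K) (b : ℕ → Fin 4 → K) (s : ℕ → State K),
      φ 0 = φ₀ ∧ (∀ k, z ∉ (φ k).vars ∧ constantCoeff (φ k) = 0) ∧
      (∀ k, s k = ⟨deletePthPowers p (FrameChange.tsch z (φ k) (c k).F), (c k).r, (c k).exc⟩) ∧
      FreeTail.IsWitnessedChain p s j b ∧
      (∀ k, (s k).r = Finsupp.single x n + Finsupp.single y n + Finsupp.single v w) ∧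
      (∀ k, j k = x ∨ j k = y) ∧
      (∀ k, ordZero (s k).F = ((p + n : ℕ) : ℕ∞)) ∧ (∀ k, IsIsolated p (s k).F) ∧
      (∀ k, Module.finrank K (ResCone.resVertex (s k)) = 3) ∧
      (∀ k, ∀ e ∈ (s k).F.support, (s k).r ≤ e) ∧
      (∀ k, (∃ a : K, a ≠ 0 ∧ ResCone.resForm (s k) = C a * X z ^ d) →
        s (k + 1) = CentreBlowup.step p Finset.univ (j k) 0 (s k)) ∧
      (∀ e : Fin 4 →₀ ℕ, ¬ IsPthPowerExponent p e → coeff e (s 0).F = coeff e (FrameChange.tsch z φ₀ (c 0).F)) := by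
  -- with `w ≠ n` the weights force every chart into a slot (T1 §1, by induction along the real chain)
  have hstepR : ∀ k, c (k + 1) = CentreBlowup.step p Finset.univ (j k) (β k) (c k) := fun k => (hwit k).2.2.2.2
  have hβj : ∀ k, β k (j k) = 0 := fun k => (hwit k).2.1
  have hrR : ∀ k, (c k).r = Finsupp.single x n + Finsupp.single y n + Finsupp.single v w := by
    intro k
    induction k with
    | zero => exact hr0
    | succ k ih =>
      obtain ⟨x', y', v', h1, h2, h3, hr'⟩ := hσtail (k + 1)
      rw [hstepR k] at hr' ⊢
      exact (step_cases_of_weights_sigma p hn hw hwn hxy hxv hxz hyv hyz hvz ih (ho k) (hjz k) (hβj k)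
        ⟨x', y', v', h1, h2, h3, hr'⟩).2.2.trans ih
  have hslotR : ∀ k, j k = x ∨ j k = y := by
    intro k
    obtain ⟨x', y', v', h1, h2, h3, hr'⟩ := hσtail (k + 1)
    rw [hstepR k] at hr'
    exact (step_cases_of_weights_sigma p hn hw hwn hxy hxv hxz hyv hyz hvz (hrR k) (ho k) (hjz k) (hβj k)
      ⟨x', y', v', h1, h2, h3, hr'⟩).1
  obtain ⟨φ, b, s, h1, h2, h3, h4, h5, h6, h7, h8, h9, h10, h11⟩ := framed_play_slot_sigma p hσ hn hw hd1 hxy hxv hxz hyv hyz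
    hvz hwit hclean hslotR hez hr0 hσtail ho hdiv0 he3 hiso hφ h0
  exact ⟨φ, b, s, h1, h2, h3, h4, h5, hslotR, h6, h7, h8, h9, h10, h11⟩

end SwapTransport

end Summit.ResolutionOfSingularities.ResolutionOfSingularities.Theorems.PIDim4

end
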